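import Literature.Analysis.FunctionSpaces.LittlewoodPaleyKernel
import Literature.Analysis.FunctionSpaces.LittlewoodPaleyMultiplierProofs
import HarnessLib

/-!
# The unit Littlewood–Paley kernel as a Laplacian: `𝓕⁻φ₀ = -Σₖ ∂ₖ∂ₖ 𝓕⁻σ_L`, `σ_L ∈ 𝓢` supported in `‖ξ‖ ≤ 2`

Helper file of the line lead of crux `stmt-NavierStokesRegularity-1538` (`TautLoopKelvin.CirculationFloor`,
line `birth`), first half of the registered stub `stub_kernelFactorisation`, landed as the registered tools
stub `stub_kernelLaplacianTools`: the complex block kernel `h₀ = blockKernelC E 0 = 𝓕⁻ φ₀` of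
`LittlewoodPaleyKernel.lean` (whose real part is the real kernel `K₀ = blockKernel E 0`) is minus the sum
of the second coordinate derivatives of `𝓕⁻ σ_L` for a Schwartz symbol `σ_L` supported in the ball
`‖ξ‖ ≤ 2`, namely `σ_L(ξ) = φ₀(ξ) ψ(ξ)/(4π²‖ξ‖²)` (`ψ` the Bernstein reproducing symbol; `truncSymbol`):
`4π²‖ξ‖² σ_L = φ₀` and `∂ₘ 𝓕⁻ f = 𝓕⁻ (2πi⟪·,m⟫ f)` (Mathlib `SchwartzMap.lineDerivOp_fourierInv_eq`).
No definitions are introduced (the symbol is produced existentially).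

* `kernel_exists_symbolL` — the symbol `σ_L` with `4π²‖ξ‖² σ_L = φ₀` and `σ_L = 0` on `2 ≤ ‖ξ‖`;
* `kernel_lineDeriv_lineDeriv_fourierInv` — `∂ₘ∂ₘ 𝓕⁻ f = 𝓕⁻ (-(4π²)⟪·,m⟫² f)`;
* `kernel_blockKernel_zero_eq_of_symbol` — the real pointwise form `K₀ = -Σₖ ∂ₖ∂ₖ Re 𝓕⁻σ`;
* `stub_kernelLaplacianTools` — the registered export.

## References

* H. Bahouri, J.-Y. Chemin, R. Danchin, *Fourier Analysis and Nonlinear PDE* (2011), Lemma 2.1–2.2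
  (`Δ̇_j u = 2^{jd} h(2^j·) ⋆ u`; homogeneous multipliers on an annulus). [BahouriCheminDanchin2011]
-/

noncomputable section

open MeasureTheory SchwartzMap Real Complex FourierTransform
open scoped FourierTransform RealInnerProductSpace LineDeriv ContDiff

-- the summit and its single sub-problem share the name (CONVENTIONS §1), as in every Theorems file
set_option linter.dupNamespace false

namespace Summit.NavierStokesRegularity.NavierStokesRegularity.Theorems.CirculationFloor.Birth

open Literature.Analysis.FunctionSpaces

/-! ### The symbol `σ_L = φ₀ ψ / (4π² ‖ξ‖²)` -/

/-- `1/‖ξ‖²` (complex-valued) is smooth off the origin. [folklore] -/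
theorem kernel_contDiffOn_invNormSq :
    ContDiffOn ℝ ∞ (fun ξ : EuclideanSpace ℝ (Fin 3) => (((‖ξ‖ ^ 2)⁻¹ : ℝ) : ℂ)) {0}ᶜ := by
  refine Complex.ofRealCLM.contDiff.comp_contDiffOn ?_
  refine ((contDiff_norm_sq ℝ).contDiffOn.inv fun ξ hξ => ?_)
  exact pow_ne_zero 2 (norm_ne_zero_iff.2 hξ)

/-- The dyadic symbols vanish at the origin. [folklore] -/
theorem kernel_dyadicSymbol_zero (j : ℤ) : dyadicSymbol j (0 : EuclideanSpace ℝ (Fin 3)) = 0 := by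
  simp [dyadicSymbol]

/-- The unit dyadic symbol `φ₀ = χ(·) - χ(2·)` vanishes on `2 ≤ ‖ξ‖`. [folklore] -/
theorem kernel_dyadicSymbol_zero_eq_zero_of_two_le {ξ : EuclideanSpace ℝ (Fin 3)} (h : 2 ≤ ‖ξ‖) :
    dyadicSymbol 0 ξ = 0 := by
  have h1 : dyadicCutoff (EuclideanSpace ℝ (Fin 3)) (((2 : ℝ) ^ (-(0 : ℤ))) • ξ) = 0 :=
    dyadicCutoff_apply_of_two_le_norm (by simpa using h)
  have h2 : dyadicCutoff (EuclideanSpace ℝ (Fin 3)) (((2 : ℝ) ^ (1 - (0 : ℤ))) • ξ) = 0 := by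
    refine dyadicCutoff_apply_of_two_le_norm ?_
    rw [sub_zero, zpow_one, norm_smul, Real.norm_eq_abs, abs_of_pos two_pos]
    linarith
  rw [dyadicSymbol, h1, h2]
  simp

/-- **The symbol `σ_L`.** There is a Schwartz function `σ_L` on `ℝ³` with `4π²‖ξ‖² σ_L(ξ) = φ₀(ξ)`
for all `ξ` and `σ_L(ξ) = 0` whenever `2 ≤ ‖ξ‖`: `σ_L = (4π²)⁻¹ · (ψ/‖ξ‖²) · φ₀` with the
block-truncated parametrix symbol of `LittlewoodPaleyMultiplierProofs` (`ψ φ₀ = φ₀`). [folklore] -/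
theorem kernel_exists_symbolL :
    ∃ S : 𝓢(EuclideanSpace ℝ (Fin 3), ℂ),
      (∀ ξ, (((4 * π ^ 2 * ‖ξ‖ ^ 2 : ℝ)) : ℂ) * S ξ = dyadicSymbol 0 ξ) ∧
      (∀ ξ, 2 ≤ ‖ξ‖ → S ξ = 0) := by
  set σ : EuclideanSpace ℝ (Fin 3) → ℂ := fun ξ => (((4 * π ^ 2)⁻¹ : ℝ) : ℂ) *
    (truncSymbol (fun ξ : EuclideanSpace ℝ (Fin 3) => (((‖ξ‖ ^ 2)⁻¹ : ℝ) : ℂ)) 0 ξ * dyadicSymbol 0 ξ)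
    with hσ
  have hsmooth : ContDiff ℝ ∞ σ :=
    contDiff_const.mul ((contDiff_truncSymbol kernel_contDiffOn_invNormSq 0).mul (contDiff_dyadicSymbol 0))
  have hsupp : HasCompactSupport σ := ((hasCompactSupport_dyadicSymbol 0).mul_left).mul_left
  refine ⟨hsupp.toSchwartzMap hsmooth, fun ξ => ?_, fun ξ hξ => ?_⟩
  · rw [HasCompactSupport.toSchwartzMap_toFun]
    by_cases hξ : ξ = 0
    · subst hξ
      simp [hσ, kernel_dyadicSymbol_zero]
    · have hbern : bernsteinSymbol ξ * dyadicSymbol 0 ξ = dyadicSymbol 0 ξ := by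
        have h := congr_fun (dyadicSymbol_mul_bernsteinSymbol_rescaled (E := EuclideanSpace ℝ (Fin 3)) 0) ξ
        simp only [Pi.mul_apply, neg_zero, zpow_zero, one_smul] at h
        rw [mul_comm]
        exact h
      have hn : (‖ξ‖ ^ 2 : ℝ) ≠ 0 := pow_ne_zero 2 (norm_ne_zero_iff.2 hξ)
      have hπ : (4 * π ^ 2 : ℝ) ≠ 0 := by positivity
      have key : ((4 * π ^ 2 * ‖ξ‖ ^ 2 : ℝ) : ℂ) *
          ((((4 * π ^ 2)⁻¹ : ℝ) : ℂ) * (((‖ξ‖ ^ 2)⁻¹ : ℝ) : ℂ)) = 1 := by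
        rw [← Complex.ofReal_mul, ← Complex.ofReal_mul, ← Complex.ofReal_one]
        congr 1
        field_simp
      simp only [hσ, truncSymbol_apply, neg_zero, zpow_zero, one_smul]
      calc ((4 * π ^ 2 * ‖ξ‖ ^ 2 : ℝ) : ℂ) *
            ((((4 * π ^ 2)⁻¹ : ℝ) : ℂ) * ((((‖ξ‖ ^ 2)⁻¹ : ℝ) : ℂ) * bernsteinSymbol ξ * dyadicSymbol 0 ξ))
          = ((4 * π ^ 2 * ‖ξ‖ ^ 2 : ℝ) : ℂ) * ((((4 * π ^ 2)⁻¹ : ℝ) : ℂ) * (((‖ξ‖ ^ 2)⁻¹ : ℝ) : ℂ)) *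
              (bernsteinSymbol ξ * dyadicSymbol 0 ξ) := by ring
        _ = dyadicSymbol 0 ξ := by rw [key, one_mul, hbern]
  · rw [HasCompactSupport.toSchwartzMap_toFun]
    simp [hσ, kernel_dyadicSymbol_zero_eq_zero_of_two_le hξ]

/-! ### Derivatives of inverse Fourier transforms of Schwartz symbols -/

/-- `⟪·, m⟫` has temperate growth. [folklore] -/
theorem kernel_hasTemperateGrowth_inner (m : EuclideanSpace ℝ (Fin 3)) :
    (fun ξ : EuclideanSpace ℝ (Fin 3) => ⟪ξ, m⟫).HasTemperateGrowth :=
  ((innerSL ℝ).flip m).hasTemperateGrowth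

/-- One derivative of the inverse Fourier transform of a Schwartz symbol: `∂ₘ 𝓕⁻ f = 𝓕⁻ g` with
`g = 2πi⟪·,m⟫ f`, which vanishes wherever `f` does. [folklore] -/
theorem kernel_lineDeriv_fourierInv (f : 𝓢(EuclideanSpace ℝ (Fin 3), ℂ))
    (m : EuclideanSpace ℝ (Fin 3)) :
    ∃ g : 𝓢(EuclideanSpace ℝ (Fin 3), ℂ),
      (∂_{m} (𝓕⁻ f) : 𝓢(EuclideanSpace ℝ (Fin 3), ℂ)) = 𝓕⁻ g ∧
      ∀ ξ, g ξ = (2 * π * Complex.I) * ((⟪ξ, m⟫ : ℝ) : ℂ) * f ξ := by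
  have hg := kernel_hasTemperateGrowth_inner m
  refine ⟨(2 * π * Complex.I) • smulLeftCLM ℂ (fun ξ : EuclideanSpace ℝ (Fin 3) => ⟪ξ, m⟫) f,
    lineDerivOp_fourierInv_eq f m, fun ξ => ?_⟩
  rw [smul_apply, smulLeftCLM_apply_apply hg, Complex.real_smul, smul_eq_mul]
  ring

/-- Two derivatives of the inverse Fourier transform of a Schwartz symbol:
`∂ₘ∂ₘ 𝓕⁻ f = 𝓕⁻ (-(4π²) ⟪·,m⟫² f)`, pointwise on the symbol side. [folklore] -/
theorem kernel_lineDeriv_lineDeriv_fourierInv (f : 𝓢(EuclideanSpace ℝ (Fin 3), ℂ))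
    (m : EuclideanSpace ℝ (Fin 3)) :
    ∃ g : 𝓢(EuclideanSpace ℝ (Fin 3), ℂ),
      (∂_{m} (∂_{m} (𝓕⁻ f)) : 𝓢(EuclideanSpace ℝ (Fin 3), ℂ)) = 𝓕⁻ g ∧
      ∀ ξ, g ξ = -(((4 * π ^ 2 * ⟪ξ, m⟫ ^ 2 : ℝ)) : ℂ) * f ξ := by
  obtain ⟨f₁, hf₁, hf₁ξ⟩ := kernel_lineDeriv_fourierInv f m
  obtain ⟨f₂, hf₂, hf₂ξ⟩ := kernel_lineDeriv_fourierInv f₁ m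
  refine ⟨f₂, by rw [hf₁, hf₂], fun ξ => ?_⟩
  rw [hf₂ξ, hf₁ξ]
  have hI : Complex.I * Complex.I = -1 := Complex.I_mul_I
  push_cast
  linear_combination (2 * π * (⟪ξ, m⟫ : ℂ)) ^ 2 * f ξ * hI

/-- **`𝓕⁻ φ₀ = -Σₖ ∂ₖ∂ₖ 𝓕⁻ σ`** for every Schwartz symbol `σ` with `4π²‖ξ‖² σ = φ₀` (sum over the
standard basis `eₖ = EuclideanSpace.single k 1`; `Σₖ ⟪ξ,eₖ⟫² = ‖ξ‖²`). [folklore] -/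
theorem kernel_blockKernelC_zero_eq_of_symbol {S : 𝓢(EuclideanSpace ℝ (Fin 3), ℂ)}
    (hS : ∀ ξ, (((4 * π ^ 2 * ‖ξ‖ ^ 2 : ℝ)) : ℂ) * S ξ = dyadicSymbol 0 ξ) :
    (blockKernelC (EuclideanSpace ℝ (Fin 3)) 0 : 𝓢(EuclideanSpace ℝ (Fin 3), ℂ)) =
      -∑ k : Fin 3, (∂_{EuclideanSpace.single k (1 : ℝ)}
        (∂_{EuclideanSpace.single k (1 : ℝ)} (𝓕⁻ S)) : 𝓢(EuclideanSpace ℝ (Fin 3), ℂ)) := by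
  choose g hg hgξ using fun k : Fin 3 =>
    kernel_lineDeriv_lineDeriv_fourierInv S (EuclideanSpace.single k (1 : ℝ))
  have hsum : ∑ k : Fin 3, (∂_{EuclideanSpace.single k (1 : ℝ)}
      (∂_{EuclideanSpace.single k (1 : ℝ)} (𝓕⁻ S)) : 𝓢(EuclideanSpace ℝ (Fin 3), ℂ)) =
      𝓕⁻ (∑ k : Fin 3, g k) := by
    rw [fourierInv_sum]
    exact Finset.sum_congr rfl fun k _ => hg k
  rw [hsum, ← fourierInv_neg, blockKernelC]
  congr 1
  ext ξ
  have hsc : (((4 * π ^ 2 * ‖ξ‖ ^ 2 : ℝ)) : ℂ) =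
      ∑ k : Fin 3, (((4 * π ^ 2 * ⟪ξ, EuclideanSpace.single k (1 : ℝ)⟫ ^ 2 : ℝ)) : ℂ) := by
    rw [← Complex.ofReal_sum, EuclideanSpace.real_norm_sq_eq, Finset.mul_sum]
    congr 1
    refine Finset.sum_congr rfl fun k _ => ?_
    rw [EuclideanSpace.inner_single_right]
    simp
  rw [neg_apply, sum_apply, coe_dyadicSymbolSchwartz, ← hS ξ, hsc, Finset.sum_mul]
  simp only [hgξ, neg_mul, Finset.sum_neg_distrib, neg_neg]

/-- The real part commutes with directional derivatives of Schwartz functions: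
`∂ᵥ (Re ∘ f)(x) = Re (∂ᵥ f (x))`. [folklore] -/
theorem kernel_fderiv_re_apply (f : 𝓢(EuclideanSpace ℝ (Fin 3), ℂ)) (x v : EuclideanSpace ℝ (Fin 3)) :
    fderiv ℝ (fun z => (f z).re) x v = (fderiv ℝ (⇑f) x v).re := by
  have h := (Complex.reCLM.hasFDerivAt.comp x (f.differentiableAt).hasFDerivAt).fderiv
  rw [show (fun z => (f z).re) = (⇑Complex.reCLM ∘ ⇑f) from rfl, h]
  rfl

/-- **`K₀ = -Σₖ ∂ₖ∂ₖ Re 𝓕⁻σ`**, the real pointwise form: if `𝓕⁻φ₀ = -Σₖ ∂ₖ∂ₖ 𝓕⁻σ` as complex Schwartz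
functions, then the real block kernel is minus the sum of the second coordinate derivatives of the real
function `Re 𝓕⁻σ`. [folklore] -/
theorem kernel_blockKernel_zero_eq_of_symbol {S : 𝓢(EuclideanSpace ℝ (Fin 3), ℂ)}
    (hK : (blockKernelC (EuclideanSpace ℝ (Fin 3)) 0 : 𝓢(EuclideanSpace ℝ (Fin 3), ℂ)) =
      -∑ k : Fin 3, (∂_{EuclideanSpace.single k (1 : ℝ)}
        (∂_{EuclideanSpace.single k (1 : ℝ)} (𝓕⁻ S)) : 𝓢(EuclideanSpace ℝ (Fin 3), ℂ)))
    (x : EuclideanSpace ℝ (Fin 3)) :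
    blockKernel (EuclideanSpace ℝ (Fin 3)) 0 x =
      -∑ k : Fin 3, fderiv ℝ (fun y => fderiv ℝ (fun z => ((𝓕⁻ S : 𝓢(EuclideanSpace ℝ (Fin 3), ℂ)) z).re) y
        (EuclideanSpace.single k (1 : ℝ))) x (EuclideanSpace.single k (1 : ℝ)) := by
  have h := congr_arg (fun F : 𝓢(EuclideanSpace ℝ (Fin 3), ℂ) => (F x).re) hK
  simp only [neg_apply, sum_apply, Complex.neg_re, Complex.re_sum] at h
  rw [blockKernel, h]
  congr 1
  refine Finset.sum_congr rfl fun k _ => ?_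
  have h1 : (fun y => fderiv ℝ (fun z => ((𝓕⁻ S : 𝓢(EuclideanSpace ℝ (Fin 3), ℂ)) z).re) y
      (EuclideanSpace.single k (1 : ℝ))) =
      fun y => ((∂_{EuclideanSpace.single k (1 : ℝ)} (𝓕⁻ S : 𝓢(EuclideanSpace ℝ (Fin 3), ℂ)) :
        𝓢(EuclideanSpace ℝ (Fin 3), ℂ)) y).re := by
    funext y
    rw [lineDerivOp_apply_eq_fderiv]
    exact kernel_fderiv_re_apply _ y _
  rw [h1, kernel_fderiv_re_apply, lineDerivOp_apply_eq_fderiv]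

/-- **Registered tools stub `stub_kernelLaplacianTools`** (first half of `stub_kernelFactorisation`):
there is a Schwartz symbol `σ_L` on `ℝ³`, vanishing on `2 ≤ ‖ξ‖`, with
`𝓕⁻ φ₀ = -Σₖ ∂ₖ∂ₖ 𝓕⁻ σ_L` as complex Schwartz functions. [folklore] -/
theorem stub_kernelLaplacianTools :
    ∃ S : SchwartzMap (EuclideanSpace ℝ (Fin 3)) ℂ,
      (∀ ξ : EuclideanSpace ℝ (Fin 3), 2 ≤ ‖ξ‖ → S ξ = 0) ∧
      Literature.Analysis.FunctionSpaces.blockKernelC (EuclideanSpace ℝ (Fin 3)) 0 =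
        -∑ k : Fin 3, LineDeriv.lineDerivOp (EuclideanSpace.single k (1 : ℝ))
          (LineDeriv.lineDerivOp (EuclideanSpace.single k (1 : ℝ))
            (FourierTransformInv.fourierInv S : SchwartzMap (EuclideanSpace ℝ (Fin 3)) ℂ)) := by
  obtain ⟨S, hS, hsupp⟩ := kernel_exists_symbolL
  exact ⟨S, hsupp, kernel_blockKernelC_zero_eq_of_symbol hS⟩

end Summit.NavierStokesRegularity.NavierStokesRegularity.Theorems.CirculationFloor.Birth

end
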